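import Summits.HodgeConjecture.CorCM.OcticWeilFourfoldTwoTransitiveOfSimple
import Summits.HodgeConjecture.CorCM.Model.CMAbelianVarietyRealisedHolds
import Literature.AlgebraicGeometry.Pohlmann1968.MumfordSimpleFourfold
import Literature.NumberTheory.NumberFields.CMQuadraticExtension
import HarnessLib

/-!
# COR-CM — NON-VACUITY for OCTIC-WEIL22: MUMFORD'S simple CM fourfold (Pohlmann 1968 §3) and the CM curve of `ℚ(i)` —
# the Hodge conjecture for all products of copies, GIVEN ONLY Markman's fourfold theorem; the hypotheses are inhabited

Cell `pub-hodgecm2` (COR-CM), seat b30 gen 19 (2026-08-21); count-neutral own lane OCTIC-WEIL22.  Theorems only, no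
definition, no named fact, no `sorry`.  HONEST FRAMING: CONDITIONAL on `HodgeTheory.Markman2025_weilClasses_algebraic_abelianFourfold`
(unrefereed); `HC_CM` is not asserted.

THE EXAMPLE (tree, lit-pohlmann: `Pohlmann1968/MumfordSimpleFourfold.lean`).  `K = F(i)`, `F = ℚ(α)` Mumford's totally real
quartic (`3α⁴ − 6α² + α + 1 = 0`), `[K:ℚ] = 8`, `j : ℚ(i) → K`, and for a `2`-set `P` of embeddings of `F` the CM type
`Φ_P = weilType P` — PRIMITIVE (`weilType_primitive`) and of Weil type `(2,2)` for `ℚ(i)` (`weilType_balanced`); every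
realisation `B ⊨ (K; Φ_P)` is a SIMPLE abelian fourfold with `B² ≠ D²` (`isSimple_and_exists_exceptional`: Mumford's
example, van Geemen Thm. 4.5).  Here:
* `finrank_Qi`, `isCMField_Qi` — `ℚ(i) = ℚ[X]/(X² + 1)` is an imaginary quadratic (CM) field;
* `card_filter_comp_j_eq_two` — `#{φ ∈ Φ_P | φ ∘ j = τ} = 2` for both `τ : ℚ(i) → ℂ`;
* **`hodgeConjectureFor_biproduct_comp_vec_mumford_of_markman`** — for every realisation `B ⊨ (K; Φ_P)` and every CM
  elliptic curve `E ⊨ (ℚ(i); Ψ)`: `HodgeConjectureFor (⨁_j ![B, E] (κ j))` for EVERY `κ` (all `B^n × E^a`), GIVEN ONLY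
  Markman's fourfold theorem (gen 19's `hodgeConjectureFor_biproduct_comp_vec_of_isSimple_of_markman₂`);
* **`exists_hypotheses_octicWeil22`** — the hypothesis set of that theorem is INHABITED: realisations `B`, `E` exist by the
  tree's UNCONDITIONAL `cmAbelianVarietyRealised_holds` (Shimura §6.2 Thm. 3, seat b17), `B` is simple and of
  `k`-signature `(2,2)` — so the lane's theorems are not vacuous.
[cite: Pohlmann1968, §3] [cite: vanGeemen1994HodgeAV, Thm. 4.5 and 4.7] [cite: Gordon1999HodgeAVSurvey, 8.2–8.3]
[cite: Markman2025SurveySecant, Thm. 1.2] [cite: Shimura1998, §6.2 Thm. 3 and §8.2 Prop. 26]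

## References
* [Pohlmann1968] H. Pohlmann, Ann. of Math. 88 (1968), §3 (Mumford's example).  [vanGeemen1994HodgeAV] B. van Geemen,
  LNM 1594 (1994), Thm. 4.5, 4.7.  [Gordon1999HodgeAVSurvey] B. B. Gordon, CRM Monogr. 10 (1999), 8.2–8.3, 5.13 (ii).
  [Markman2025SurveySecant] E. Markman, arXiv:2509.23403, Thm. 1.2.  [Shimura1998] G. Shimura, §6.2 Thm. 3, §8.2 Prop. 26.
-/

noncomputable section

open CategoryTheory CategoryTheory.Limits NumberField Polynomial

namespace Summit.HodgeConjecture.CorCM.OcticWeilFourfold.MumfordExample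

open Literature.AlgebraicGeometry Literature.AlgebraicGeometry.Motives Literature.AlgebraicGeometry.HodgeTheory
open Literature.AlgebraicGeometry.ComplexMultiplication (IsCMTypeRealisation)
open Literature.AlgebraicTopology.SingularHomology
open Literature.AlgebraicGeometry.Pohlmann1968.MumfordFourfold (K Qi j quadPolyRat weilType weilType_primitive
  weilType_balanced finrank_K isSimple_and_exists_exceptional)
open Literature.NumberTheory.NumberFields.MumfordQuartic (F)
open Summit.HodgeConjecture.CorCM.OcticCurveFourfold (card_filter_comp_eq_four)
open Summit.HodgeConjecture.CorCM.DihedralSexticPairCurvePowers (ncard_sep_eq_card_filter)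

open scoped Classical

/-! ## §1 `ℚ(i)` is an imaginary quadratic CM field; the `(2,2)` count -/

/-- `[ℚ(i) : ℚ] = 2`. [folklore] -/
theorem finrank_Qi : Module.finrank ℚ Qi = 2 := by
  have hne : (quadPolyRat : ℚ[X]) ≠ 0 := (Fact.out : Irreducible quadPolyRat).ne_zero
  have h := (AdjoinRoot.powerBasis hne).finrank
  have hdeg : (quadPolyRat : ℚ[X]).natDegree = 2 := by
    unfold Literature.AlgebraicGeometry.Pohlmann1968.MumfordFourfold.quadPolyRat
    compute_degree!
  rw [AdjoinRoot.powerBasis_dim, hdeg] at h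
  exact h

/-- `ℚ(i)` is a CM field (a totally imaginary quadratic extension of the totally real field `ℚ`: `i² = −1`).
[cite: Shimura1998, §8.4 Example (1)] -/
theorem isCMField_Qi : IsCMField Qi :=
  Literature.NumberTheory.NumberFields.isCMField_of_isTotallyReal_of_finrank_eq_two ℚ Qi finrank_Qi Nat.one_pos
    (x := AdjoinRoot.root quadPolyRat) (by
      have h0 : eval₂ (AdjoinRoot.of quadPolyRat) (AdjoinRoot.root quadPolyRat) quadPolyRat = 0 :=
        AdjoinRoot.eval₂_root quadPolyRat
      rw [eval₂_add, eval₂_X_pow, eval₂_C, map_one] at h0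
      rw [eq_neg_of_add_eq_zero_left h0]
      norm_num)

/-- **The `(2,2)` count**: for `|P| = 2` and every `τ : ℚ(i) → ℂ`, exactly two of the four embeddings of `K` over `τ` lie in
`Φ_P` (`weilType_balanced`: as many inside as outside; four in all). [cite: vanGeemen1994HodgeAV, 4.7]
[cite: Gordon1999HodgeAVSurvey, 8.3] -/
theorem card_filter_comp_j_eq_two {P : Finset (F →+* ℂ)} (hP : P.card = 2) (τ : Qi →+* ℂ) :
    (Finset.univ.filter fun φ : K →+* ℂ => φ.comp j = τ ∧ φ ∈ (weilType P).1).card = 2 := by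
  have hbal := weilType_balanced hP τ
  rw [← ncard_sep_eq_card_filter Finset.univ (fun φ : K →+* ℂ => φ.comp j = τ ∧ φ ∈ (weilType P).1)]
    at *
  have h4 := card_filter_comp_eq_four j finrank_K finrank_Qi τ
  have hsplit := Finset.card_filter_add_card_filter_not
    (s := Finset.univ.filter fun φ : K →+* ℂ => φ.comp j = τ) (fun φ => φ ∈ (weilType P).1)
  rw [Finset.filter_filter, Finset.filter_filter, h4] at hsplit
  have hin : {φ : K →+* ℂ | φ.comp j = τ ∧ φ ∈ (weilType P).1}.ncard =
      (Finset.univ.filter fun φ : K →+* ℂ => φ.comp j = τ ∧ φ ∈ (weilType P).1).card := by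
    rw [← ncard_sep_eq_card_filter]; simp
  have hout : {φ : K →+* ℂ | φ.comp j = τ ∧ φ ∉ (weilType P).1}.ncard =
      (Finset.univ.filter fun φ : K →+* ℂ => φ.comp j = τ ∧ φ ∉ (weilType P).1).card := by
    rw [← ncard_sep_eq_card_filter]; simp
  rw [hin, hout] at hbal
  simp only [Finset.mem_univ, true_and]
  omega

/-! ## §2 The Hodge conjecture for `B^n × E^a`, `B` Mumford's fourfold, `E` the CM curve of `ℚ(i)` -/

section Main

variable {N : ℕ} {P : Finset (F →+* ℂ)} {B : AbelianVariety ℂ} {ιB : 𝓞 K →+* End B}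
  {θB : K →+* Module.End ℂ (complexBetti B.X 1)}
  {Ψ : CMType Qi} {E : AbelianVariety ℂ} {ιE : 𝓞 Qi →+* End E} {θE : Qi →+* Module.End ℂ (complexBetti E.X 1)}

/-- **MUMFORD'S FOURFOLD × THE CM CURVE OF `ℚ(i)`: the Hodge conjecture for every product of copies, GIVEN ONLY Markman's
fourfold theorem.**  For `|P| = 2`, every realisation `B ⊨ (K; Φ_P)` (a simple CM abelian fourfold with `B² ≠ D²`, of Weil type
`(2,2)` for `ℚ(i)` — Mumford's example) and every CM elliptic curve `E ⊨ (ℚ(i); Ψ)`: every rational `(q,q)`-class on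
`⨁_j ![B, E] (κ j)` is algebraic, for every `κ : Fin N → Fin 2`. [cite: Markman2025SurveySecant, Thm. 1.2] [cite: Pohlmann1968, §3]
[cite: vanGeemen1994HodgeAV, Thm. 4.5 and 4.7] -/
theorem hodgeConjectureFor_biproduct_comp_vec_mumford_of_markman (hW4 : Markman2025_weilClasses_algebraic_abelianFourfold)
    (hP : P.card = 2) (hB : IsCMTypeRealisation (weilType P) B ιB θB) (hE : IsCMTypeRealisation Ψ E ιE θE)
    (κ : Fin N → Fin 2) :
    HodgeConjectureFor (⨁ fun m => (![B, E] : Fin 2 → AbelianVariety ℂ) (κ m)).dim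
      (⨁ fun m => (![B, E] : Fin 2 → AbelianVariety ℂ) (κ m)).X := by
  haveI : IsCMField Qi := isCMField_Qi
  obtain ⟨a₀⟩ : Nonempty (Qi →+* ℂ) := inferInstance
  obtain ⟨τ, hτΨ⟩ : ∃ τ, τ ∈ Ψ.1 := by
    by_cases h : a₀ ∈ Ψ.1
    · exact ⟨a₀, h⟩
    · exact ⟨ComplexEmbedding.conjugate a₀, (Ψ.2 _).2 (by rw [ComplexEmbedding.involutive_conjugate Qi a₀]; exact h)⟩
  exact hodgeConjectureFor_biproduct_comp_vec_of_isSimple_of_markman₂ hW4 finrank_K finrank_Qi j hB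
    (isSimple_and_exists_exceptional hP hB).1 hE hτΨ (card_filter_comp_j_eq_two hP τ) κ

/-- **… and for everything dominated by such a product.** [cite: Markman2025SurveySecant, Thm. 1.2] [cite: MumfordAV1970, §19] -/
theorem hodgeConjectureFor_of_avDominatedBy_comp_vec_mumford_of_markman
    (hW4 : Markman2025_weilClasses_algebraic_abelianFourfold)
    (hP : P.card = 2) (hB : IsCMTypeRealisation (weilType P) B ιB θB) (hE : IsCMTypeRealisation Ψ E ιE θE)
    (κ : Fin N → Fin 2) {C : AbelianVariety ℂ}
    (hC : Domination.AVDominatedBy C (⨁ fun m => (![B, E] : Fin 2 → AbelianVariety ℂ) (κ m))) :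
    HodgeConjectureFor C.dim C.X :=
  Domination.hodgeConjectureFor_of_avDominatedBy (hodgeConjectureFor_biproduct_comp_vec_mumford_of_markman hW4 hP hB hE κ) hC

end Main

/-! ## §3 The hypotheses of OCTIC-WEIL22 are inhabited -/

/-- **NON-VACUITY.**  There exist an octic CM field `K`, an imaginary quadratic CM field `k` with `i : k → K`, a CM type `Φ`
of `K` with a SIMPLE realisation `B` of `k`-signature `(2,2)` (`#{s ∈ Φ | s ∘ i = τ} = 2` for every `τ`), and a CM elliptic
curve `E ⊨ (k; Ψ)` — namely Mumford's fourfold and the CM curve of `ℚ(i)`, realised by the tree's UNCONDITIONAL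
`cmAbelianVarietyRealised_holds` (Shimura §6.2 Thm. 3).  So the theorems of `CorCM/OcticWeilFourfoldTwoTransitiveOfSimple.lean`
and `CorCM/SimpleCMFourfoldCurvePowersHodgeOfMarkman.lean` have inhabited hypotheses. [cite: Shimura1998, §6.2 Thm. 3]
[cite: Pohlmann1968, §3] [cite: vanGeemen1994HodgeAV, Thm. 4.5] -/
theorem exists_hypotheses_octicWeil22 :
    ∃ (K k : Type) (_ : Field K) (_ : NumberField K) (_ : IsCMField K) (_ : Field k) (_ : NumberField k) (_ : IsCMField k)
      (i : k →+* K) (Φ : CMType K) (B : AbelianVariety ℂ) (ιB : 𝓞 K →+* End B)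
      (θB : K →+* Module.End ℂ (complexBetti B.X 1)) (Ψ : CMType k) (E : AbelianVariety ℂ) (ιE : 𝓞 k →+* End E)
      (θE : k →+* Module.End ℂ (complexBetti E.X 1)),
      Module.finrank ℚ K = 8 ∧ Module.finrank ℚ k = 2 ∧ IsCMTypeRealisation Φ B ιB θB ∧ B.IsSimple ∧
        IsCMTypeRealisation Ψ E ιE θE ∧
        ∀ τ : k →+* ℂ, (Finset.univ.filter fun s : K →+* ℂ => s.comp i = τ ∧ s ∈ Φ.1).card = 2 := by
  haveI : IsCMField Qi := isCMField_Qi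
  -- a `2`-set of embeddings of `F`
  obtain ⟨P, -, hP⟩ := Finset.exists_subset_card_eq (s := (Finset.univ : Finset (F →+* ℂ))) (n := 2)
    (by rw [Finset.card_univ, Literature.NumberTheory.NumberFields.MumfordQuartic.card_embeddings]; norm_num)
  -- realisations of `(K; Φ_P)` and of a CM type of `ℚ(i)`
  obtain ⟨B, ιB, θB, hB⟩ := cmAbelianVarietyRealised_holds K (weilType P)
  obtain ⟨τ₁⟩ : Nonempty (Qi →+* ℂ) := inferInstance
  let Ψ : CMType Qi := Literature.NumberTheory.ComplexMultiplication.CMTypeCount.single finrank_Qi τ₁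
  obtain ⟨E, ιE, θE, hE⟩ := cmAbelianVarietyRealised_holds Qi Ψ
  exact ⟨K, Qi, inferInstance, inferInstance, inferInstance, inferInstance, inferInstance, inferInstance, j, weilType P, B,
    ιB, θB, Ψ, E, ιE, θE, finrank_K, finrank_Qi, hB, (isSimple_and_exists_exceptional hP hB).1, hE,
    fun τ => card_filter_comp_j_eq_two hP τ⟩

end Summit.HodgeConjecture.CorCM.OcticWeilFourfold.MumfordExample

end
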